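import Summits.HodgeConjecture.CorCM.Census.CyclicCharacterArcCoordinates

/-!
# Cyclic characters, XLII: THE INTERVAL RULE for every `k` — one face per interval-tie block, toward the LEFT END of its interval of nearest arc types

COR-CM (cell `pub-hodgecm2`), count-neutral kernel combinatorics by the binder seat b09 (gen 44; lane CYCLIC-CHARACTER FIBRE LAW, part XLII — the `k ≥ 3`
version of part XXXVIʼs lower rule, cf. `HOME/pub-hodgecm2-b09/lean-g44/LOWER-RULE-ROADMAP.md`), on part XLI and gen 38/39ʼs covering currency
(`toward_of_explicit`) BY NAME.  Theorems only (no definition, no `decide`, no certificate, no named fact, no `sorry`).  HONEST FRAMING: `HC_CM` is NOT proved,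
here or anywhere in the tree; nothing here is a period or a headline.

An INTERVAL DATUM `(Q, r)` at a type `Z` says that the arc types realising the potential of `Z` are EXACTLY `T_0·Q⁻¹ = T_{a₀}, T_{a₀+1}, …, T_{a₀+r}` with
`r + 1 < 2ᵏ` (a proper interval of the cycle of arc types): `∀ P, bpot Z = ddist (T_0·P⁻¹) Z ↔ ∃ i ≤ r, w P = w Q − i`.  For `k = 2` the two-way ties of part
XXXVI are the case `r = 1`; for every `k` the sub-balanced types of part XLI carry interval data.
* §1 **THE LEFT END IS UNIQUE** (`apply_eq_of_intDatum`): two interval data at the same type have the same left end `T_0·Q⁻¹` (a proper interval of a cycle has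
  one left end); data transport along base changes (`intDatum_rt`).
* §2 **THE INTERVAL-RULED FAMILY** (`exists_intervalRuled`): for a decidable predicate on blocks equivalent to «potential `≥ 2` and the representative carries an
  interval datum» and an excluded block `E`: a face family, one per such block `≠ E`, such that every lattice containing its base changes has the toward
  property through those blocks and, for EVERY interval datum `(Q, r)` at every type `Z` of them, a face `gface Z s s'` flipping two deviation places of `Z`
  from the left end `T_0·Q⁻¹`.

## References
* [Pohlmann1968] H. Pohlmann, Algebraic cycles on abelian varieties of complex multiplication type, Ann. of Math. 88 (1968), Thm 1.
-/

namespace Summit.HodgeConjecture.CorCM.Census.CyclicCharacter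

open Finset
open Summit.HodgeConjecture.CorCM.Prior.AllgGroup.RfwfAllgGroup
open Summit.HodgeConjecture.CorCM.Census.BlockParity
open Summit.HodgeConjecture.CorCM.Census.Coinvariant
open Summit.HodgeConjecture.CorCM.Census.TwistGeneration
open Summit.HodgeConjecture.CorCM.Census.BaseBlock

noncomputable section

variable {G : Type*} [Group G] [Fintype G] [DecidableEq G] {k : ℕ} {w : G → ZMod (2 ^ k)} {c : G}

/-! ## §1 The left end of an interval datum is unique; transport -/

omit [Group G] [Fintype G] [DecidableEq G] in
/-- A natural number cast to `0` in `ℤ/2ᵏ` is a multiple of `2ᵏ`, hence `0` or `≥ 2ᵏ`. [folklore] -/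
theorem le_of_natCast_eq_zero {i : ℕ} (h : (i : ZMod (2 ^ k)) = 0) (hi : i ≠ 0) : 2 ^ k ≤ i := by
  rw [ZMod.natCast_eq_zero_iff] at h
  exact Nat.le_of_dvd (Nat.pos_of_ne_zero hi) h

/-- **THE LEFT END OF AN INTERVAL DATUM IS UNIQUE**: two interval data `(Q, r)`, `(Q', r')` at the same type have `w Q = w Q'` (properness of ONE of the two
intervals suffices). [folklore] -/
theorem apply_eq_of_intDatum (hw : ∀ P Q : G, w (P * Q) = w P + w Q) (hk : 1 ≤ k) (hc2 : c * c = 1) (hwc : w c ≠ 0) (h1 : ∃ g₁ : G, w g₁ = 1)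
    {Z : CMF G c} {Q Q' : G} {r r' : ℕ} (hr : r + 1 < 2 ^ k)
    (hQ : ∀ P : G, bpot c (arcType hw hk hc2 hwc 0) Z = ddist (rt c P (arcType hw hk hc2 hwc 0)) Z ↔ ∃ i : ℕ, i ≤ r ∧ w P = w Q - (i : ZMod (2 ^ k)))
    (hQ' : ∀ P : G, bpot c (arcType hw hk hc2 hwc 0) Z = ddist (rt c P (arcType hw hk hc2 hwc 0)) Z ↔ ∃ i : ℕ, i ≤ r' ∧ w P = w Q' - (i : ZMod (2 ^ k))) :
    w Q = w Q' := by
  -- `w Q = w Q' − i'` and `w Q' = w Q − i`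
  obtain ⟨i', hi', hQi'⟩ := (hQ' Q).mp ((hQ Q).mpr ⟨0, Nat.zero_le _, by rw [Nat.cast_zero, sub_zero]⟩)
  by_cases h0 : i' = 0
  · rw [hQi', h0, Nat.cast_zero, sub_zero]
  · -- then `T_0·(g₁Q)⁻¹`, one step to the left of the left end of `(Q, r)`, realises the potential by `(Q', r')`: contradiction
    exfalso
    obtain ⟨g₁, hg₁⟩ := h1
    have hP : bpot c (arcType hw hk hc2 hwc 0) Z = ddist (rt c (g₁ * Q) (arcType hw hk hc2 hwc 0)) Z := by
      refine (hQ' (g₁ * Q)).mpr ⟨i' - 1, by omega, ?_⟩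
      rw [hw, hg₁, hQi', Nat.cast_sub (by omega : 1 ≤ i'), Nat.cast_one]; ring
    obtain ⟨i'', hi'', hQi''⟩ := (hQ (g₁ * Q)).mp hP
    rw [hw, hg₁] at hQi''
    have hzero : ((i'' + 1 : ℕ) : ZMod (2 ^ k)) = 0 := by
      rw [Nat.cast_add, Nat.cast_one]
      linear_combination hQi''
    have := le_of_natCast_eq_zero hzero (by omega)
    omega

/-- **Interval data transport along base changes**: `(Q, r)` at `Z` gives `(P·Q, r)` at `Z·P⁻¹`. [folklore] -/
theorem intDatum_rt (hw : ∀ P Q : G, w (P * Q) = w P + w Q) (hk : 1 ≤ k) (hc2 : c * c = 1) (hwc : w c ≠ 0) {Z : CMF G c} {Q : G} {r : ℕ} (P : G)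
    (hQ : ∀ P' : G, bpot c (arcType hw hk hc2 hwc 0) Z = ddist (rt c P' (arcType hw hk hc2 hwc 0)) Z ↔ ∃ i : ℕ, i ≤ r ∧ w P' = w Q - (i : ZMod (2 ^ k))) :
    ∀ P' : G, bpot c (arcType hw hk hc2 hwc 0) (rt c P Z) = ddist (rt c P' (arcType hw hk hc2 hwc 0)) (rt c P Z) ↔
      ∃ i : ℕ, i ≤ r ∧ w P' = w (P * Q) - (i : ZMod (2 ^ k)) := by
  intro P'
  have e : ddist (rt c P' (arcType hw hk hc2 hwc 0)) (rt c P Z) = ddist (rt c (P⁻¹ * P') (arcType hw hk hc2 hwc 0)) Z := by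
    conv_lhs => rw [show P' = P * (P⁻¹ * P') by rw [mul_inv_cancel_left], rt_mul, ddist_rt]
  rw [bpot_rt, e, hQ (P⁻¹ * P')]
  constructor
  · rintro ⟨i, hi, h⟩
    refine ⟨i, hi, ?_⟩
    rw [hw, map_inv hw] at h
    rw [hw]
    calc w P' = -w P + w P' + w P := by ring
      _ = w Q - (i : ZMod (2 ^ k)) + w P := by rw [h]
      _ = w P + w Q - (i : ZMod (2 ^ k)) := by ring
  · rintro ⟨i, hi, h⟩
    refine ⟨i, hi, ?_⟩
    rw [hw, map_inv hw, h, hw]; ring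

/-! ## §2 The interval-ruled family -/

/-- **THE INTERVAL-RULED FAMILY** (see the file header). [folklore] -/
theorem exists_intervalRuled (hw : ∀ P Q : G, w (P * Q) = w P + w Q) (hk : 1 ≤ k) (hc2 : c * c = 1) (hwc : w c ≠ 0)
    (h1 : ∃ g₁ : G, w g₁ = 1) (tie : Block c → Prop) [DecidablePred tie]
    (htie : ∀ Bk : Block c, tie Bk ↔ (2 ≤ bpot c (arcType hw hk hc2 hwc 0) Bk.out ∧
      ∃ (Q : G) (r : ℕ), r + 1 < 2 ^ k ∧ ∀ P : G, bpot c (arcType hw hk hc2 hwc 0) Bk.out = ddist (rt c P (arcType hw hk hc2 hwc 0)) Bk.out ↔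
        ∃ i : ℕ, i ≤ r ∧ w P = w Q - (i : ZMod (2 ^ k)))) (E : Block c) :
    ∃ St : Finset (CMF G c →₀ ℤ), (↑St ⊆ gfaceSet G c hc2) ∧ St.card ≤ (univ.filter fun Bk : Block c => tie Bk ∧ Bk ≠ E).card ∧
      ∀ L : Submodule ℤ (CMF G c →₀ ℤ), Submodule.span ℤ (translates c St) ≤ L →
        (∀ Φ : CMF G c, tie (blk c Φ) → blk c Φ ≠ E → ∃ Q t t' : G,
          bpot c (arcType hw hk hc2 hwc 0) Φ = ddist (rt c Q (arcType hw hk hc2 hwc 0)) Φ ∧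
            t ∈ (rt c Q (arcType hw hk hc2 hwc 0)).1 \ Φ.1 ∧ t' ∈ (rt c Q (arcType hw hk hc2 hwc 0)).1 \ Φ.1 ∧ t ≠ t' ∧ gface c hc2 Φ t t' ∈ L) ∧
        (∀ (Φ : CMF G c) (Q : G) (r : ℕ), blk c Φ ≠ E → 2 ≤ bpot c (arcType hw hk hc2 hwc 0) Φ → r + 1 < 2 ^ k →
          (∀ P : G, bpot c (arcType hw hk hc2 hwc 0) Φ = ddist (rt c P (arcType hw hk hc2 hwc 0)) Φ ↔ ∃ i : ℕ, i ≤ r ∧ w P = w Q - (i : ZMod (2 ^ k))) →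
          ∃ s s' : G, s ∈ (rt c Q (arcType hw hk hc2 hwc 0)).1 \ Φ.1 ∧ s' ∈ (rt c Q (arcType hw hk hc2 hwc 0)).1 \ Φ.1 ∧ s ≠ s' ∧
            gface c hc2 Φ s s' ∈ L) := by
  classical
  set T₀ := arcType hw hk hc2 hwc 0 with hT₀
  -- the choice at every interval-tie block: an interval datum and two deviation places from its left end
  have hch : ∀ Bk : Block c, ∃ τ : (G × ℕ) × (G × G), tie Bk →
      τ.1.2 + 1 < 2 ^ k ∧ (∀ P : G, bpot c T₀ Bk.out = ddist (rt c P T₀) Bk.out ↔ ∃ i : ℕ, i ≤ τ.1.2 ∧ w P = w τ.1.1 - (i : ZMod (2 ^ k))) ∧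
        τ.2.1 ∈ (rt c τ.1.1 T₀).1 \ Bk.out.1 ∧ τ.2.2 ∈ (rt c τ.1.1 T₀).1 \ Bk.out.1 ∧ τ.2.1 ≠ τ.2.2 := by
    intro Bk
    by_cases h : tie Bk
    · obtain ⟨h2, Q, r, hr, hQ⟩ := (htie Bk).mp h
      have hQ0 : bpot c T₀ Bk.out = ddist (rt c Q T₀) Bk.out := (hQ Q).mpr ⟨0, Nat.zero_le _, by rw [Nat.cast_zero, sub_zero]⟩
      have hcard : 1 < ((rt c Q T₀).1 \ Bk.out.1).card := by rw [hQ0, ddist] at h2; omega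
      obtain ⟨s, hs, s', hs', hss'⟩ := one_lt_card.mp hcard
      exact ⟨((Q, r), (s, s')), fun _ => ⟨hr, hQ, hs, hs', hss'⟩⟩
    · exact ⟨((1, 0), (1, 1)), fun h' => absurd h' h⟩
  choose τ hτ using hch
  set NI : Finset (Block c) := univ.filter fun Bk : Block c => tie Bk ∧ Bk ≠ E with hNI
  set face : Block c → (CMF G c →₀ ℤ) := fun Bk => gface c hc2 Bk.out (τ Bk).2.1 (τ Bk).2.2 with hface
  refine ⟨NI.image face, ?_, card_image_le, fun L hL => ⟨fun Φ hΦ hΦE => ?_, fun Φ Q₁ r₁ hΦE h2 hr₁ hQ₁ => ?_⟩⟩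
  · intro y hy
    obtain ⟨Bk, hBk, rfl⟩ := mem_image.mp (mem_coe.mp hy)
    obtain ⟨-, -, hs, hs', hss'⟩ := hτ Bk (mem_filter.mp hBk).2.1
    exact ⟨Bk.out, _, _, not_mem_orb_of_mem (mem_sdiff.mp hs).1 (mem_sdiff.mp hs').1 hss', rfl⟩
  · have hmem : face (blk c Φ) ∈ NI.image face := mem_image_of_mem _ (mem_filter.mpr ⟨mem_univ _, hΦ, hΦE⟩)
    obtain ⟨-, hQ, hs, hs', hss'⟩ := hτ (blk c Φ) hΦ
    have hQ0 : bpot c T₀ (blk c Φ).out = ddist (rt c (τ (blk c Φ)).1.1 T₀) (blk c Φ).out :=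
      (hQ _).mpr ⟨0, Nat.zero_le _, by rw [Nat.cast_zero, sub_zero]⟩
    exact toward_of_explicit c T₀ hc2 L hQ0 hs hs' hss' (fun Q'' => hL (Submodule.subset_span ⟨Q'', _, hmem, rfl⟩)) (blk_out c (blk c Φ)).symm
  · set Bk : Block c := blk c Φ with hBk
    obtain ⟨P, hP⟩ := exists_rt_eq_of_blk_eq c (blk_out c Bk)
    have hinv : rt c P⁻¹ Φ = Bk.out := by rw [← hP, rt_inv_rt]
    -- the datum `(P⁻¹Q₁, r₁)` at `Bk.out` shows the block is an interval-tie block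
    have hdat := intDatum_rt hw hk hc2 hwc P⁻¹ hQ₁
    rw [hinv] at hdat
    have hpot : bpot c T₀ Φ = bpot c T₀ Bk.out := by rw [← bpot_rt c T₀ P Bk.out, hP]
    have htieBk : tie Bk := (htie _).mpr ⟨by rw [← hpot]; exact h2, _, _, hr₁, hdat⟩
    have hmem : face Bk ∈ NI.image face := mem_image_of_mem _ (mem_filter.mpr ⟨mem_univ _, htieBk, hΦE⟩)
    obtain ⟨hr, hQ, hs, hs', hss'⟩ := hτ Bk htieBk
    -- transport the blockʼs datum to `Φ` and compare left ends
    have hdat' := intDatum_rt hw hk hc2 hwc P hQ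
    rw [hP] at hdat'
    have hlow : rt c (P * (τ Bk).1.1) T₀ = rt c Q₁ T₀ := by
      rw [hT₀, rt_arcType_zero_eq, rt_arcType_zero_eq, apply_eq_of_intDatum hw hk hc2 hwc h1 hr hdat' hQ₁]
    have hfaceL : gface c hc2 Φ ((τ Bk).2.1 * P⁻¹) ((τ Bk).2.2 * P⁻¹) ∈ L := by
      have h := hL (Submodule.subset_span ⟨P, face Bk, hmem, rfl⟩)
      rwa [show face Bk = gface c hc2 Bk.out (τ Bk).2.1 (τ Bk).2.2 from rfl, mapDomain_rt_gface, hP] at h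
    refine ⟨(τ Bk).2.1 * P⁻¹, (τ Bk).2.2 * P⁻¹, ?_, ?_, fun h => hss' (mul_right_cancel h), hfaceL⟩
    · rw [← hlow, rt_mul, ← hP, mem_sdiff_rt_iff, inv_mul_cancel_right]; exact hs
    · rw [← hlow, rt_mul, ← hP, mem_sdiff_rt_iff, inv_mul_cancel_right]; exact hs'

end

end Summit.HodgeConjecture.CorCM.Census.CyclicCharacter
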